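import Summits.QuantumFields.YangMills.Theorems.AlphaInputsT3ACv3DataSchemaLC
import Summits.QuantumFields.YangMills.Theorems.AlphaInputsT3ACRecordWitness
import Summits.QuantumFields.YangMills.Theorems.AlphaInputsT3ACv4SeamWindowDL
import HarnessLib

/-!
# `AlphaInputsT3ACv4RecordConstants` — THE `γ₀`-TOLERANCE ROW OF THE v4 NESTED RECORD IS FREE: records with exact profile `(b₀, p₀)`, the three `C68`-sizes, the collar
# `7L + 3 ≤ M₁` AND `γ₀ ≤ ((φ(C68)∕(b₀Q₀(p₀)))²)²` for ANY positive tolerance `φ` exist beyond a threshold, from ANY seed record — lane `pub-balaban3d`, width seat alpha-2 (g8; v4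
# package ∕ display owner)

WHY (cell `ym3-torus`, route `UnitScaleTilt`, crux `HistoryTailL` = stmt-QuantumFields-19936; stub 2′χ-v4 `AlphaInputsT3ACv4RecChi`).  The v4 closer of record
✓ `HistoryTailSelSupplier.laneRecordsV4Chi_of_thm1In8_nestedDataRows_dL` (★w6-19936 g2, `…v4SeamWindowDL`) reads, per odd `L > 1` and per `(B, a₀, a₁)` of the supplier's box, the
rows `∃ b₁ p₁, ∀ b₀ ≥ b₁, p₀ ≥ p₁, ∀ φ > 0 on (0, ∞), ∃ 𝔠 : AlphaConsts L 2` with `𝔠.b₀ = b₀`, `𝔠.p₀ = p₀`, `𝔠.B₃ = B`, the three `C68`-sizes, `7L + 3 ≤ 𝔠.M₁`, the NUMERAL-FREE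
tolerance row `𝔠.gamma0 ≤ ((φ 𝔠.C68 ∕ (𝔠.b₀·Q₀ 𝔠.p₀))²)²` (display ✓ `…v4RecordNested`, this seat g7), and NODE O's (O⁗χ) rows for `𝔠`.  The record's threshold `γ₀` is NOT a free
field: `𝔠.gamma0 = min(1, γ₂₈, γ₄₆, γ_OO, γ₇₁)` is DERIVED from the constants (`Proofs/Primitives.lean` §3), and `γ₇₁ = γ(σ₆₈(C68, L))` alone does NOT meet the tolerance the `_dL`
fold instantiates (`φ(C) = D′(L, C)⁻¹`, `D′ ∼ C⁸L⁴`).  LOCATED + CERTIFIED HERE: the row is nevertheless FREE — `γ₂₈ = min 1 ((ρ∕4)∕(c_B·K₂₈ + 1))² ≤ (ρ∕4)²` and the chart radius `ρ > 0`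
enters NOTHING but `γ₂₈` and the chart profile `𝔠.chart` handed to NODE O's rows — where its three consumers are ANTITONE in `ρ`: G3D-01 `ChartAnalyticityAsCited (Ψ Y) ρ M`
(= `0 < ρ ∧ DifferentiableOn ℂ Ψ (ball 0 ρ) ∧ sup on closedBall (ρ∕2)`, §3), the gauge-invariance-in-the-chart rows `inv26 : ∀ b ∈ ball 0 ρ, π u b ∈ ball 0 ρ → Ψ (π u b) = Ψ b`
(a smaller ball asks less) of `AlphaAdaptersAC`∕`LogZLocalizedAsCited`, and the (28)-smallness `small28 : c_B·r(g)g p(g) ≤ ρ∕4`, which the lane itself discharges from `γ ≤ γ₂₈`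
(`Proofs/Family.lean`) — so SHRINKING `ρ` after `b₀, p₀, C68, M₁` are fixed (`b₀`'s defining equation does not mention `ρ`) puts `γ₀` below any positive tolerance, changes no
other displayed row, and takes nothing from the (O⁗χ) supplier:
* §1 `RecordConstants.gamma0_le_gamma28`, `gamma28_le_sq_rho` (`γ₂₈ ≤ (ρ∕4)²`), ★ `gamma0_le_of_rho_le` (`ρ ≤ 4√T ⇒ γ₀ ≤ T`);
* §2 ★★ `AlphaInputsT3AC.exists_record_sizes_M₁_gamma0` — ✓ `exists_record_sizes_M₁` (this seat g3) WITH the tolerance row for every positive `φ`: the record rows of the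
  nested v4 display cost the (O⁗χ) supplier NOTHING beyond choosing its own O(1)'s in a seed `𝔠₀` (kept: `B₃`; enlarged: `M₁ ↦ max M₁ (7L+3)`, `C68`; tuned: `r₀`, `cJ35` for the
  profile; shrunk: `ρ`);
* §3 `RecordConstants.chartAnalyticityAsCited_anti` — the (30)-row at radius `ρ₀` implies it at every `0 < ρ ≤ ρ₀` (why the `ρ`-shrink takes nothing from NODE O);
* §4 (v1.1) ★ `AlphaInputsT3AC.pinnedPartsT3ACRecNestedV4Chi_shell` — the CONSTANTS SHELL of the nested v4 display `PinnedPartsT3ACRecNestedV4Chi L` (every row except (T)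
  `Thm1GlobalMinAt` and the per-family (O⁗χ) clause, INCLUDING the collar and the `∀ φ` tolerance row) HOLDS at every `L > 1` — the v4 twin of ★alpha-1's
  ✓ `pinnedPartsT3ACRec_shell`: all content of 2′χ-v4 is (T) + (O⁗χ);
* §5 (v1.2, after LEAD RULING L-R3 «V4-VORTEX: (i) SAT — the Sel∕Xs display is the display of record, the nested one is vacuous at clause (2)@i=0») ★★
  `AlphaInputsT3AC.pinnedPartsT3ACRecSelXsV4Chi_shell` — the CONSTANTS-AND-SEAM SHELL of the display OF RECORD `PinnedPartsT3ACRecSelXsV4Chi L`: every row except (T) and the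
  per-family (O‴χₛ) selection clause, INCLUDING the per-family seam row `SmallFactor71OfRecT3` (through §4's free tolerance row at ★w6-19936 g2's floor-free `D′(L, C68)` and
  ✓ `smallFactor71OfRecT3_of_gamma0_dL_cast`), holds at every `L > 1`.
HONEST FRAMING.  Bookkeeping about the lane's constants record; certifies that the `∀ φ` tolerance row of `PinnedPartsT3ACRecNestedV4Chi` is satisfiable jointly with the size∕collar
rows (non-vacuity of the display's record part) — it does NOT touch (T) [7] Thm 1, NODE O's (O⁗χ) rows, the stub `stub_laneRecordsV4Chi`, or the crux; count-neutral helper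
(`--supports stmt-QuantumFields-19936`); registry untouched.  YM₃ on the three-torus is rung R3 of the programme, NOT the Clay problem: nothing here bears on d = 4, infinite
volume, or a mass gap.

References: T. Bałaban, Commun. Math. Phys. 102 (1985) 255–275 [Balaban1985UV3] ((7) p.257, (28)–(30) p.263, (68)–(71) p.273).
-/

set_option autoImplicit false

noncomputable section

namespace Summit.QuantumFields.YangMills.Theorems

open Metric Set
open Literature.MathematicalPhysics.QuantumFieldTheory.Balaban1983to89
open Literature.MathematicalPhysics.QuantumFieldTheory.Balaban1983to89.T3ContinuumYM3Torus
open Literature.MathematicalPhysics.QuantumFieldTheory.Balaban1985CMP102.Binders (ChartAnalyticityAsCited)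
open Literature.MathematicalPhysics.QuantumFieldTheory.Balaban1985CMP102.Setting
open Summit.QuantumFields.Balaban3D.Carriers
open Summit.QuantumFields.Balaban3D.Proofs.Primitives
open Summit.QuantumFields.Balaban3D.Proofs.Constants (gammaMin_le)
open Summit.QuantumFields.Balaban3D.Proofs.ChartThreshold (K28 K28_nonneg)
open Summit.QuantumFields.Balaban3D.Proofs.Thresholds (Q0 Q0_pos)
open B7Prop2Explicit (C0 C0_pos)

/-! ## §1 `γ₀ ≤ γ₂₈ ≤ (ρ∕4)²` -/

namespace RecordConstants

variable {L N : ℕ}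

/-- `γ₀ ≤ γ₂₈` (the group's threshold is the minimum of the listed seat thresholds). [cite: Balaban1985UV3, p.256 L15–18 and (28) p.263] -/
theorem gamma0_le_gamma28 (𝔠 : AlphaConsts L N) : 𝔠.gamma0 ≤ 𝔠.gamma28 :=
  gammaMin_le (by simp)

/-- **`γ₂₈ ≤ (ρ∕4)²`**: `γ₂₈ = min 1 ((ρ∕4)∕(c_B·K₂₈ + 1))²` with `c_B·K₂₈ + 1 ≥ 1`. [cite: Balaban1985UV3, (28) p.263] -/
theorem gamma28_le_sq_rho (𝔠 : AlphaConsts L N) : 𝔠.gamma28 ≤ (𝔠.ρ / 4) ^ 2 := by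
  have hK : 0 ≤ K28 𝔠.r₀ 𝔠.b₀ 𝔠.p₀ := K28_nonneg 𝔠.b₀_pos.le (by linarith [𝔠.r₀_add_p₀_nonneg])
  have hD : 1 ≤ 𝔠.cB * K28 𝔠.r₀ 𝔠.b₀ 𝔠.p₀ + 1 := by nlinarith [𝔠.cB_nonneg]
  have hρ : 0 ≤ 𝔠.ρ / 4 := by have := 𝔠.ρ_pos; positivity
  have h1 : (𝔠.ρ / 4) / (𝔠.cB * K28 𝔠.r₀ 𝔠.b₀ 𝔠.p₀ + 1) ≤ 𝔠.ρ / 4 := div_le_self hρ hD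
  have h0 : 0 ≤ (𝔠.ρ / 4) / (𝔠.cB * K28 𝔠.r₀ 𝔠.b₀ 𝔠.p₀ + 1) := div_nonneg hρ (by linarith)
  calc 𝔠.gamma28 = min 1 (((𝔠.ρ / 4) / (𝔠.cB * K28 𝔠.r₀ 𝔠.b₀ 𝔠.p₀ + 1)) ^ 2) := rfl
    _ ≤ ((𝔠.ρ / 4) / (𝔠.cB * K28 𝔠.r₀ 𝔠.b₀ 𝔠.p₀ + 1)) ^ 2 := min_le_right _ _
    _ ≤ (𝔠.ρ / 4) ^ 2 := pow_le_pow_left₀ h0 h1 2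

/-- ★ **`ρ ≤ 4√T ⇒ γ₀ ≤ T`** (`T ≥ 0`): the record's threshold sits below any prescribed tolerance once the chart radius is small. [cite: Balaban1985UV3, (28) p.263] -/
theorem gamma0_le_of_rho_le (𝔠 : AlphaConsts L N) {T : ℝ} (hT : 0 ≤ T) (hρ : 𝔠.ρ ≤ 4 * Real.sqrt T) : 𝔠.gamma0 ≤ T := by
  have hρ4 : 𝔠.ρ / 4 ≤ Real.sqrt T := by linarith
  have hρ0 : 0 ≤ 𝔠.ρ / 4 := by have := 𝔠.ρ_pos; positivity
  calc 𝔠.gamma0 ≤ 𝔠.gamma28 := gamma0_le_gamma28 𝔠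
    _ ≤ (𝔠.ρ / 4) ^ 2 := gamma28_le_sq_rho 𝔠
    _ ≤ (Real.sqrt T) ^ 2 := pow_le_pow_left₀ hρ0 hρ4 2
    _ = T := Real.sq_sqrt hT

end RecordConstants

/-! ## §2 Records with exact profile, the three `C68`-sizes, the collar and ANY `γ₀`-tolerance exist -/

section Record

/-- ★★ **RECORDS WITH EXACT PROFILE, ALL THREE `C68`-SIZES, `7L + 3 ≤ M₁` AND THE `γ₀`-TOLERANCE ROW EXIST BEYOND A THRESHOLD, FOR EVERY POSITIVE TOLERANCE.**  For every seed
`𝔠₀` and every `a₁ > 0` there is `b₁` such that for all `b₀ ≥ b₁`, `p₀ ≥ 3` and every `φ : ℝ → ℝ` positive on `(0, ∞)` there is a record `𝔠` with `𝔠.b₀ = b₀`, `𝔠.p₀ = p₀`,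
`𝔠.B₃ = 𝔠₀.B₃`, the three `C68`-sizes, `7L + 3 ≤ 𝔠.M₁`, `𝔠.gamma0 ≤ ((φ 𝔠.C68∕(𝔠.b₀·Q₀ 𝔠.p₀))²)²`, and `𝔠.ρ ≤ 𝔠₀.ρ` — ✓ `exists_record_sizes_M₁` followed by the `ρ`-shrink of §1 at
`T := ((φ C68∕(b₀Q₀))²)²`.  So the record part of the v4 nested display's `hrows` is FREE. [cite: Balaban1985UV3, (7) p.257, (28) p.263 and (68)–(71) p.273 (bookkeeping)] -/
theorem AlphaInputsT3AC.exists_record_sizes_M₁_gamma0 {L N : ℕ} (𝔠₀ : AlphaConsts L N) {a₁ : ℝ} (ha₁ : 0 < a₁) :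
    ∃ b₁ : ℝ, 0 ≤ b₁ ∧ ∀ (b₀ p₀ : ℝ), b₁ ≤ b₀ → 3 ≤ p₀ → ∀ (φ : ℝ → ℝ), (∀ x : ℝ, 0 < x → 0 < φ x) →
      ∃ 𝔠 : AlphaConsts L N, 𝔠.b₀ = b₀ ∧ 𝔠.p₀ = p₀ ∧ 𝔠.B₃ = 𝔠₀.B₃ ∧
        4 * 𝔠.B₃ * (L : ℝ) ^ 2 * avgWindowFactor L ≤ 𝔠.C68 ∧
        Real.exp (𝔠.p₀ - 1) ≤ 3 * C0 3 * 𝔠.C68 * (𝔠.b₀ * Q0 𝔠.p₀) ∧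
        (𝔠.b₀ * Q0 𝔠.p₀) * (2 * (L : ℝ) ^ 2 * avgWindowFactor L) ^ 2 ≤ 3 * C0 3 * 𝔠.C68 * a₁ ^ 2 ∧
        7 * L + 3 ≤ 𝔠.M₁ ∧
        𝔠.gamma0 ≤ ((φ 𝔠.C68 / (𝔠.b₀ * Q0 𝔠.p₀)) ^ 2) ^ 2 ∧
        𝔠.ρ ≤ 𝔠₀.ρ := by
  -- the seed with the big block enlarged (as in `exists_record_sizes_M₁`), profile and `C68` by `exists_alphaConsts_profile`, then the `ρ`-shrink
  let 𝔠₁ : AlphaConsts L N := { 𝔠₀ with M₁ := max 𝔠₀.M₁ (7 * L + 3), M₁_pos := lt_max_of_lt_left 𝔠₀.M₁_pos }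
  have hM₁ : 7 * L + 3 ≤ 𝔠₁.M₁ := le_max_right _ _
  have hB₁ : 𝔠₁.B₃ = 𝔠₀.B₃ := rfl
  have hρ₁ : 𝔠₁.ρ = 𝔠₀.ρ := rfl
  obtain ⟨b₁, hb₁, h⟩ := AlphaInputsT3AC.exists_alphaConsts_profile 𝔠₁
  refine ⟨b₁, hb₁, fun b₀ p₀ hb hp φ hφ => ?_⟩
  obtain ⟨𝔠, h1, h2, hc, -, hB, hM, -, -, hρ, -, -⟩ := h b₀ p₀
    (max (4 * 𝔠₀.B₃ * (L : ℝ) ^ 2 * avgWindowFactor L)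
      (max (Real.exp (p₀ - 1) / (3 * C0 3 * (b₀ * Q0 p₀)))
        ((b₀ * Q0 p₀) * (2 * (L : ℝ) ^ 2 * avgWindowFactor L) ^ 2 / (3 * C0 3 * a₁ ^ 2)))) hb hp
  have hb0 : 0 < b₀ := h1 ▸ 𝔠.b₀_pos
  have hp0 : 0 < p₀ := h2 ▸ 𝔠.p₀_pos
  obtain ⟨s1, s2, s3⟩ := MinimiserPin.sizes_of_C68_ge (B₃ := 𝔠₀.B₃) (B := avgWindowFactor L) ha₁ hb0 hp0 hc
  -- the tolerance at the chosen `C68` and the prescribed profile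
  have hT : 0 < ((φ 𝔠.C68 / (b₀ * Q0 p₀)) ^ 2) ^ 2 := by
    have := hφ _ 𝔠.C68_pos; have := Q0_pos hp0; positivity
  -- the shrunk record
  let 𝔠' : AlphaConsts L N :=
    { 𝔠 with ρ := min 𝔠.ρ (4 * Real.sqrt (((φ 𝔠.C68 / (b₀ * Q0 p₀)) ^ 2) ^ 2)), ρ_pos := lt_min 𝔠.ρ_pos (by positivity) }
  have hb' : 𝔠'.b₀ = b₀ := h1
  have hp' : 𝔠'.p₀ = p₀ := h2
  have hC' : 𝔠'.C68 = 𝔠.C68 := rfl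
  refine ⟨𝔠', hb', hp', hB.trans hB₁, ?_, ?_, ?_, ?_, ?_, ?_⟩
  · show 4 * 𝔠.B₃ * (L : ℝ) ^ 2 * avgWindowFactor L ≤ 𝔠.C68
    rw [hB, hB₁]; exact s1
  · rw [hb', hp', hC']; exact s2
  · rw [hb', hp', hC']; exact s3
  · show 7 * L + 3 ≤ 𝔠.M₁
    rw [hM]; exact hM₁
  · rw [hb', hp', hC']
    exact RecordConstants.gamma0_le_of_rho_le 𝔠' hT.le (min_le_right _ _)
  · show min 𝔠.ρ _ ≤ 𝔠₀.ρ
    exact (min_le_left _ _).trans (hρ.trans hρ₁).le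

end Record

/-! ## §3 Why the `ρ`-shrink takes nothing from NODE O: the (30)-row is antitone in the radius -/

namespace RecordConstants

/-- **THE CHART-ANALYTICITY ROW IS ANTITONE IN THE RADIUS**: `ChartAnalyticityAsCited Ψ ρ₀ M` and `0 < ρ ≤ ρ₀` give `ChartAnalyticityAsCited Ψ ρ M` (the ball shrinks, the
sup-bound is asked on a smaller closed ball).  Hence NODE O's G3D-01 row at print's radius serves every shrunk record of §1–§2. [cite: Balaban1985UV3, (30) p.263] -/
theorem chartAnalyticityAsCited_anti {E F : Type*} [NormedAddCommGroup E] [NormedSpace ℂ E] [NormedAddCommGroup F] [NormedSpace ℂ F]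
    {Ψ : E → F} {ρ₀ ρ M : ℝ} (h : ChartAnalyticityAsCited Ψ ρ₀ M) (hρ : 0 < ρ) (hle : ρ ≤ ρ₀) :
    ChartAnalyticityAsCited Ψ ρ M :=
  ⟨hρ, h.2.1.mono (ball_subset_ball hle), fun z hz => h.2.2 z (closedBall_subset_closedBall (by linarith) hz)⟩

end RecordConstants

/-! ## §4 (v1.1) The constants shell of the nested v4 display -/

section Shell

open Literature.MathematicalPhysics.QuantumFieldTheory.Balaban1983to89.ExpMeanLog (deltaSU)

/-- ★ **THE CONSTANTS SHELL OF `AlphaInputsT3AC.PinnedPartsT3ACRecNestedV4Chi L` HOLDS** for every block size `L > 1`: thresholds `b₁`, `p₁ := 3` such that for every profile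
beyond them AND every tolerance `φ` positive on `(0, ∞)` there is a record with EXACTLY that profile and [7] constants `a₀ = a₁ > 0` (★alpha-1's `a₁`-witness) with `B₃a₁ ≤ a₀`,
the small-`a₁` rows, `1 ≤ 2B₃` (`B₃ := 1`), the three `C68`-rows, the collar `7L + 3 ≤ M₁` AND the tolerance row `γ₀ ≤ ((φ(C68)∕(b₀Q₀(p₀)))²)²` — i.e. the nested v4 display
(✓ `…v4RecordNested` §2) with its two mass rows (T) `Thm1GlobalMinAt` and the per-family (O⁗χ) clause deleted.  CERTIFICATE that the display's record bookkeeping is jointly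
satisfiable and free; all content of 2′χ-v4 is (T) + (O⁗χ). [cite: Balaban1985UV3, (7) p.257, (28) p.263, (40) p.266 and (68)–(71) p.273 (bookkeeping); Balaban1985Variational, Thm 1 (6)–(8) pp.278–279 (constants regime)] -/
theorem AlphaInputsT3AC.pinnedPartsT3ACRecNestedV4Chi_shell {L : ℕ} (hL : 1 < L) (N : ℕ) :
    ∃ (b₁ p₁ : ℝ), ∀ (b₀ p₀ : ℝ), b₁ ≤ b₀ → p₁ ≤ p₀ → ∀ (φ : ℝ → ℝ), (∀ x : ℝ, 0 < x → 0 < φ x) →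
      ∃ (𝔠 : AlphaConsts L N) (a₀ a₁ : ℝ), 𝔠.b₀ = b₀ ∧ 𝔠.p₀ = p₀ ∧ 0 < a₀ ∧ 0 < a₁ ∧ 𝔠.B₃ * a₁ ≤ a₀ ∧
        (143 * ((((3 + 4 : ℕ) : ℝ)) ^ 2 / 4) ^ 2) * (2 * (𝔠.B₃ * a₁)) ≤ 1 / 3 ∧
        2 * (2 * (𝔠.B₃ * a₁)) ≤ 2 * deltaSU (Fin 2) / (((3 + 4) * L : ℕ) : ℝ) ^ 2 ∧
        1 ≤ 2 * 𝔠.B₃ ∧ 4 * 𝔠.B₃ * (L : ℝ) ^ 2 * avgWindowFactor L ≤ 𝔠.C68 ∧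
        Real.exp (𝔠.p₀ - 1) ≤ 3 * C0 3 * 𝔠.C68 * (𝔠.b₀ * Q0 𝔠.p₀) ∧
        (𝔠.b₀ * Q0 𝔠.p₀) * (2 * (L : ℝ) ^ 2 * avgWindowFactor L) ^ 2 ≤ 3 * C0 3 * 𝔠.C68 * a₁ ^ 2 ∧
        7 * L + 3 ≤ 𝔠.M₁ ∧
        𝔠.gamma0 ≤ ((φ 𝔠.C68 / (𝔠.b₀ * Q0 𝔠.p₀)) ^ 2) ^ 2 := by
  -- the [7] constant `a₁(L)` (★alpha-1's witness) and the seed with `B₃ := 1`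
  set a₁ : ℝ := min (1 / (6 * (143 * ((((3 + 4 : ℕ) : ℝ)) ^ 2 / 4) ^ 2))) (deltaSU (Fin 2) / (2 * (((3 + 4) * L : ℕ) : ℝ) ^ 2))
    with ha₁_def
  have ha₁ : 0 < a₁ := AlphaInputsT3AC.a₁Witness_pos L hL
  obtain ⟨𝔠₀, h𝔠₀⟩ := AlphaInputsT3AC.exists_alphaConsts hL N one_pos
  obtain ⟨b₁, -, h⟩ := AlphaInputsT3AC.exists_record_sizes_M₁_gamma0 𝔠₀ ha₁
  refine ⟨b₁, 3, fun b₀ p₀ hb hp φ hφ => ?_⟩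
  obtain ⟨𝔠, h1, h2, hB, s1, s2, s3, hM, hg, -⟩ := h b₀ p₀ hb hp φ hφ
  have hB1 : 𝔠.B₃ = 1 := hB.trans h𝔠₀
  refine ⟨𝔠, a₁, a₁, h1, h2, ha₁, ha₁, by rw [hB1, one_mul], ?_, ?_, by rw [hB1]; norm_num, s1, s2, s3, hM, hg⟩
  · -- `143·(7²/4)²·(2·a₁) ≤ ⅓` from `a₁ ≤ 1/(6·143·(7²/4)²)`
    rw [hB1, one_mul]
    have hle : a₁ ≤ 1 / (6 * (143 * ((((3 + 4 : ℕ) : ℝ)) ^ 2 / 4) ^ 2)) := min_le_left _ _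
    calc 143 * ((((3 + 4 : ℕ) : ℝ)) ^ 2 / 4) ^ 2 * (2 * a₁)
        ≤ 143 * ((((3 + 4 : ℕ) : ℝ)) ^ 2 / 4) ^ 2 * (2 * (1 / (6 * (143 * ((((3 + 4 : ℕ) : ℝ)) ^ 2 / 4) ^ 2)))) := by gcongr
      _ = 1 / 3 := by field_simp; ring
  · -- `2·(2·a₁) ≤ 2δ/(7L)²` from `a₁ ≤ δ/(2(7L)²)`
    rw [hB1, one_mul]
    have hle : a₁ ≤ deltaSU (Fin 2) / (2 * (((3 + 4) * L : ℕ) : ℝ) ^ 2) := min_le_right _ _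
    calc 2 * (2 * a₁) ≤ 2 * (2 * (deltaSU (Fin 2) / (2 * (((3 + 4) * L : ℕ) : ℝ) ^ 2))) := by gcongr
      _ = 2 * deltaSU (Fin 2) / (((3 + 4) * L : ℕ) : ℝ) ^ 2 := by field_simp

/-- **IN PARTICULAR FOR THE LANE's MODEL `SU(2) ⊂ U((suGroupModel 2).N)`**: the constants shell of the nested v4 display holds at the record type the registered stub text
`stub_laneRecordsV4Chi` quantifies over. [cite: Balaban1985UV3, (7) p.257 (bookkeeping)] -/
theorem AlphaInputsT3AC.pinnedPartsT3ACRecNestedV4Chi_shell_su2 {L : ℕ} (hL : 1 < L) :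
    ∃ (b₁ p₁ : ℝ), ∀ (b₀ p₀ : ℝ), b₁ ≤ b₀ → p₁ ≤ p₀ → ∀ (φ : ℝ → ℝ), (∀ x : ℝ, 0 < x → 0 < φ x) →
      ∃ (𝔠 : AlphaConsts L (suGroupModel 2).N) (a₀ a₁ : ℝ), 𝔠.b₀ = b₀ ∧ 𝔠.p₀ = p₀ ∧ 0 < a₀ ∧ 0 < a₁ ∧ 𝔠.B₃ * a₁ ≤ a₀ ∧
        (143 * ((((3 + 4 : ℕ) : ℝ)) ^ 2 / 4) ^ 2) * (2 * (𝔠.B₃ * a₁)) ≤ 1 / 3 ∧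
        2 * (2 * (𝔠.B₃ * a₁)) ≤ 2 * deltaSU (Fin 2) / (((3 + 4) * L : ℕ) : ℝ) ^ 2 ∧
        1 ≤ 2 * 𝔠.B₃ ∧ 4 * 𝔠.B₃ * (L : ℝ) ^ 2 * avgWindowFactor L ≤ 𝔠.C68 ∧
        Real.exp (𝔠.p₀ - 1) ≤ 3 * C0 3 * 𝔠.C68 * (𝔠.b₀ * Q0 𝔠.p₀) ∧
        (𝔠.b₀ * Q0 𝔠.p₀) * (2 * (L : ℝ) ^ 2 * avgWindowFactor L) ^ 2 ≤ 3 * C0 3 * 𝔠.C68 * a₁ ^ 2 ∧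
        7 * L + 3 ≤ 𝔠.M₁ ∧
        𝔠.gamma0 ≤ ((φ 𝔠.C68 / (𝔠.b₀ * Q0 𝔠.p₀)) ^ 2) ^ 2 :=
  AlphaInputsT3AC.pinnedPartsT3ACRecNestedV4Chi_shell hL _

end Shell

/-! ## §5 (v1.2) The constants-and-seam shell of the display of record `PinnedPartsT3ACRecSelXsV4Chi` -/

section ShellSelXs

open Literature.MathematicalPhysics.QuantumFieldTheory.Balaban1983to89.ExpMeanLog (deltaSU)

/-- ★★ **THE CONSTANTS-AND-SEAM SHELL OF THE DISPLAY OF RECORD `AlphaInputsT3AC.PinnedPartsT3ACRecSelXsV4Chi L` HOLDS** (every `L > 1`; LEAD RULING L-R3 made the Sel∕Xs display the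
display of record after the V4-VORTEX hazard emptied the nested one): thresholds `b₁`, `p₁` such that for every profile beyond them there are a record with EXACTLY that profile and [7]
constants `a₀ = a₁ > 0` with the small-`a₁` rows, `1 ≤ 2B₃`, the three `C68`-rows, the collar `7L + 3 ≤ M₁` (extra, harmless) AND, for EVERY family `F` with `F.L = L` and every
`(γ, K)` of the window, the per-family SEAM ROW `SmallFactor71OfRecT3 F (hF ▸ 𝔠) γ hγ hγ1 K` — i.e. the display of record with ONLY (T) `Thm1GlobalMinAt` and the per-family (O‴χₛ)
selection clause deleted.  Proof: §4's shell at the tolerance `φ C := D′(L, C)⁻¹` + ✓ `smallFactor71OfRecT3_of_gamma0_dL_cast` (★w6-19936 g2, floor-free).  CERTIFICATE that the display of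
record's bookkeeping AND seam rows are jointly satisfiable: all content of 2′χ-v4 is (T) + (O‴χₛ). [cite: Balaban1985UV3, (7) p.257, (28) p.263 and (67)–(71) p.273 (bookkeeping); Balaban1985Variational, Thm 1 (6)–(8) pp.278–279] -/
theorem AlphaInputsT3AC.pinnedPartsT3ACRecSelXsV4Chi_shell {L : ℕ} (hL : 1 < L) :
    ∃ (b₁ p₁ : ℝ), ∀ (b₀ p₀ : ℝ), b₁ ≤ b₀ → p₁ ≤ p₀ →
      ∃ (𝔠 : AlphaConsts L (suGroupModel 2).N) (a₀ a₁ : ℝ), 𝔠.b₀ = b₀ ∧ 𝔠.p₀ = p₀ ∧ 0 < a₀ ∧ 0 < a₁ ∧ 𝔠.B₃ * a₁ ≤ a₀ ∧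
        (143 * ((((3 + 4 : ℕ) : ℝ)) ^ 2 / 4) ^ 2) * (2 * (𝔠.B₃ * a₁)) ≤ 1 / 3 ∧
        2 * (2 * (𝔠.B₃ * a₁)) ≤ 2 * deltaSU (Fin 2) / (((3 + 4) * L : ℕ) : ℝ) ^ 2 ∧
        1 ≤ 2 * 𝔠.B₃ ∧ 4 * 𝔠.B₃ * (L : ℝ) ^ 2 * avgWindowFactor L ≤ 𝔠.C68 ∧
        Real.exp (𝔠.p₀ - 1) ≤ 3 * C0 3 * 𝔠.C68 * (𝔠.b₀ * Q0 𝔠.p₀) ∧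
        (𝔠.b₀ * Q0 𝔠.p₀) * (2 * (L : ℝ) ^ 2 * avgWindowFactor L) ^ 2 ≤ 3 * C0 3 * 𝔠.C68 * a₁ ^ 2 ∧
        7 * L + 3 ≤ 𝔠.M₁ ∧
        ∀ (F : T3Family) (hF : F.L = L) (γ : ℝ) (hγ : 0 < γ) (hγ1 : γ ≤ (min (hF ▸ 𝔠).gamma0 1) ^ 2) (K : ℕ),
          AlphaInputsT3AC.SmallFactor71OfRecT3 F (hF ▸ 𝔠) γ hγ hγ1 K := by
  obtain ⟨b₁, p₁, h⟩ := AlphaInputsT3AC.pinnedPartsT3ACRecNestedV4Chi_shell_su2 hL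
  refine ⟨b₁, p₁, fun b₀ p₀ hb hp => ?_⟩
  obtain ⟨𝔠, a₀, a₁, h1, h2, h3, h4, h5, hA3, hA2, hB₃, hC, hCe, hCa, hM₁, hg⟩ := h b₀ p₀ hb hp
    (fun C => (36288000 * (L : ℝ) ^ 2 * C +
      2 * (2 * C * ((11612160000 * (L : ℝ) ^ 2 + 1331529 / 4) * C ^ 2) + ((11612160000 * (L : ℝ) ^ 2 + 1331529 / 4) * C ^ 2) ^ 2) + 1)⁻¹)
    (fun C hC => by positivity)
  exact ⟨𝔠, a₀, a₁, h1, h2, h3, h4, h5, hA3, hA2, hB₃, hC, hCe, hCa, hM₁,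
    fun F hF => AlphaInputsT3AC.smallFactor71OfRecT3_of_gamma0_dL_cast hg F hF⟩

end ShellSelXs

end Summit.QuantumFields.YangMills.Theorems

end
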